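import Summits.CriticalPhenomena.CardyFormulaZ2.Theorems.CardyComplexConeCoherentMoreraModeSelection
import Summits.CriticalPhenomena.CardyFormulaZ2.Theorems.CardyComplexConeCoherentMoreraCoherenceShift
import Summits.CriticalPhenomena.CardyFormulaZ2.Theorems.CardyComplexConeCoherentMoreraKirchhoff
import HarnessLib

/-!
# Line `potential-darboux-picard-diamond`, conjunct (b′) of S3: the two modes of a coherent corner observable

Helper file of the conditional stub of S3 (b′) `ClosedClass` of crux `ParafermionToSLESixFamilies`
(stmt-CriticalPhenomena-11389), line `potential-darboux-picard-diamond`; the percolation-free MODE SELECTION for potentials.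

At a lattice vertex `v` the face potential `Ψ` of an exact pair has, on the faces `NE = v`, `NW = v − e₀`, `SE = v − e₁`,
the increments `−E(v,NE)`, `−i E(v,NW)`, `+i E(v,SE)` from `Φ v`, so its holomorphic vertex defect
`(i − 1)Ψ(NE) − iΨ(NW) + Ψ(SE)` is the HOLOMORPHIC CORNER DEFECT `holDefect E v = (1 − i)E(v,v) − E(v,v−e₀) + iE(v,v−e₁)`
of the corner observable, and the defect of `conj Ψ` is the conjugate of the ANTIHOLOMORPHIC CORNER DEFECT
`antiDefect E v = (1 + i)E(v,v) + E(v,v−e₀) + iE(v,v−e₁)`. **Main statement** (`pairedSmall_of_edgeCoherence`, registered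
helper): under the route item `EdgeCoherence` ONE of the two defects is `o(δ^{1/3})` in horizontal pairs `v, v + e₀`,
uniformly on compacts, for EVERY guarded family — the same alternative for all families (it is read off the universal
class vector `u`). Proof = the landed mode-selection algebra of crux `CoherentMorera`: with `w = u ∘ classShift` also a
coherence vector (`stub_coherenceShift`), either a minor `u(o⋆)w(o) − u(o)w(o⋆)` is non-zero and ALL corner values are
`o(δ^{1/3})` (`ModeSelection.elim_bound`), or `u` is a character vector `u(0)·(1, χ, χ², χ³)` on the classes
`0, −e₀, −e₀−e₁, −e₁` with `χ⁴ = 1`; `χ = 1` and `χ = −i` kill `holDefect` pointwise, `χ = −1` (and `−i`) kill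
`antiDefect` pointwise, and for the staggered character `χ = i` Kirchhoff's vertex relation (`stub_kirchhoff`) gives
`E(v,v) + E(v+e₀,v+e₀) = o(δ^{1/3})`, which kills `holDefect` in PAIRS.
-/

noncomputable section

namespace Summit.CriticalPhenomena.CardyFormulaZ2.Cruxes.ParafermionToSLESixFamilies.PotentialDarbouxPicardDiamond

open scoped Topology
open Filter Set Metric Complex
open Literature.Probability Literature.Probability.LatticeModels Literature.Probability.Percolation
open Literature.Probability.RandomPlanarGeometry
open Summit.CriticalPhenomena.CardyFormulaZ2.Theses.CardyComplexCone (EdgeCoherence)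
open Summit.CriticalPhenomena.CardyFormulaZ2.Cruxes.CoherentMorera
open Summit.CriticalPhenomena.CardyFormulaZ2.Cruxes.CoherentMorera.FinitaryGreenPairing
  (e0 e1 classShift classShift_iter_four EdgeCoherenceWith Guards KirchhoffRel cornersAt stub_coherenceShift
    stub_kirchhoff medialPoint_horizontal meshPoint_add_e0)
open Summit.CriticalPhenomena.CardyFormulaZ2.Cruxes.CoherentMorera.FinitaryGreenPairing.ModeSelection

/-! ## The two corner defects -/

/-- The HOLOMORPHIC CORNER DEFECT at the vertex `v` of a corner function `E`:
`(1 − i) E(v, v) − E(v, v − e₀) + i E(v, v − e₁)` (classes `0, −e₀, −e₁`). -/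
def holDefect (E : Site 2 × Site 2 → ℂ) (v : Site 2) : ℂ :=
  (1 - I) * E (v, v) - E (v, v - e0) + I * E (v, v - e1)

/-- The ANTIHOLOMORPHIC CORNER DEFECT at the vertex `v` of a corner function `E`:
`(1 + i) E(v, v) + E(v, v − e₀) + i E(v, v − e₁)`. -/
def antiDefect (E : Site 2 × Site 2 → ℂ) (v : Site 2) : ℂ :=
  (1 + I) * E (v, v) + E (v, v - e0) + I * E (v, v - e1)

/-! ## Pointwise algebra -/

section Pointwise

variable {E : Site 2 × Site 2 → ℂ} {u : Site 2 → ℂ} {v : Site 2} {t : ℝ}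

/-- The three coherence defects of `u` at `v` between the class `0` and the classes `−e₀`, `−e₀−e₁`, `−e₁`. -/
theorem coh_defects (hU : ∀ f f', IsCorner v f → IsCorner v f' →
      ‖u (f' - v) * E (v, f) - u (f - v) * E (v, f')‖ ≤ t) :
    ‖u (-e0) * E (v, v) - u 0 * E (v, v - e0)‖ ≤ t ∧
      ‖u (-e0 - e1) * E (v, v) - u 0 * E (v, v - e0 - e1)‖ ≤ t ∧
        ‖u (-e1) * E (v, v) - u 0 * E (v, v - e1)‖ ≤ t := by
  obtain ⟨c0, c1, c2, c3⟩ := isCorner_site v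
  refine ⟨?_, ?_, ?_⟩
  · have h := hU _ _ c0 c1; rwa [sub_sub_cancel_left, sub_self] at h
  · have h := hU _ _ c0 c2; rwa [show v - e0 - e1 - v = -e0 - e1 by abel, sub_self] at h
  · have h := hU _ _ c0 c3; rwa [sub_sub_cancel_left, sub_self] at h

/-- **The conformal characters kill the holomorphic defect.** If `u(−e₀) = χ u(0)`, `u(−e₁) = χ³ u(0)` with `χ = 1` or
`χ = −i`, then `‖u 0‖ · ‖holDefect E v‖ ≤ 2t`. -/
theorem holDefect_bound {χ : ℂ} (hχ : χ = 1 ∨ χ = -I) (h1 : u (-e0) = χ * u 0) (h3 : u (-e1) = χ ^ 3 * u 0)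
    (hU : ∀ f f', IsCorner v f → IsCorner v f' → ‖u (f' - v) * E (v, f) - u (f - v) * E (v, f')‖ ≤ t) :
    ‖u 0‖ * ‖holDefect E v‖ ≤ 2 * t := by
  obtain ⟨d1, -, d3⟩ := coh_defects hU
  rw [h1] at d1
  rw [h3] at d3
  have hc : (1 - I) - χ + I * χ ^ 3 = 0 := by
    rcases hχ with rfl | rfl
    · ring
    · linear_combination (1 - I ^ 2) * I_sq
  have key : u 0 * holDefect E v = ((1 - I) - χ + I * χ ^ 3) * (u 0 * E (v, v))
      - (u 0 * E (v, v - e0) - χ * u 0 * E (v, v)) - I * (χ ^ 3 * u 0 * E (v, v) - u 0 * E (v, v - e1)) := by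
    simp only [holDefect]; ring
  rw [← norm_mul, key, hc, zero_mul, zero_sub]
  calc ‖-(u 0 * E (v, v - e0) - χ * u 0 * E (v, v)) - I * (χ ^ 3 * u 0 * E (v, v) - u 0 * E (v, v - e1))‖
      ≤ ‖-(u 0 * E (v, v - e0) - χ * u 0 * E (v, v))‖ + ‖I * (χ ^ 3 * u 0 * E (v, v) - u 0 * E (v, v - e1))‖ :=
        norm_sub_le _ _
    _ ≤ t + t := by
        rw [norm_neg, norm_sub_rev, norm_mul, norm_I, one_mul]
        exact add_le_add d1 d3
    _ = 2 * t := by ring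

/-- **The anticonformal characters kill the antiholomorphic defect.** If `u(−e₀) = χ u(0)`, `u(−e₁) = χ³ u(0)` with
`χ = −1` or `χ = −i`, then `‖u 0‖ · ‖antiDefect E v‖ ≤ 2t`. -/
theorem antiDefect_bound {χ : ℂ} (hχ : χ = -1 ∨ χ = -I) (h1 : u (-e0) = χ * u 0) (h3 : u (-e1) = χ ^ 3 * u 0)
    (hU : ∀ f f', IsCorner v f → IsCorner v f' → ‖u (f' - v) * E (v, f) - u (f - v) * E (v, f')‖ ≤ t) :
    ‖u 0‖ * ‖antiDefect E v‖ ≤ 2 * t := by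
  obtain ⟨d1, -, d3⟩ := coh_defects hU
  rw [h1] at d1
  rw [h3] at d3
  have hc : (1 + I) + χ + I * χ ^ 3 = 0 := by
    rcases hχ with rfl | rfl
    · ring
    · linear_combination (1 - I ^ 2) * I_sq
  have key : u 0 * antiDefect E v = ((1 + I) + χ + I * χ ^ 3) * (u 0 * E (v, v))
      + (u 0 * E (v, v - e0) - χ * u 0 * E (v, v)) - I * (χ ^ 3 * u 0 * E (v, v) - u 0 * E (v, v - e1)) := by
    simp only [antiDefect]; ring
  rw [← norm_mul, key, hc, zero_mul, zero_add]
  calc ‖(u 0 * E (v, v - e0) - χ * u 0 * E (v, v)) - I * (χ ^ 3 * u 0 * E (v, v) - u 0 * E (v, v - e1))‖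
      ≤ ‖u 0 * E (v, v - e0) - χ * u 0 * E (v, v)‖ + ‖I * (χ ^ 3 * u 0 * E (v, v) - u 0 * E (v, v - e1))‖ :=
        norm_sub_le _ _
    _ ≤ t + t := by
        rw [norm_sub_rev, norm_mul, norm_I, one_mul]
        exact add_le_add d1 d3
    _ = 2 * t := by ring

/-- **The staggered character kills the holomorphic defect in pairs.** If `u(−e₀) = i u(0)`, `u(−e₀−e₁) = −u(0)`,
`u(−e₁) = −i u(0)`, `u` is coherent at `v` and at `v + e₀`, and Kirchhoff's relation holds at the edge `s(v, v + e₀)`,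
then `‖u 0‖ · ‖holDefect E v + holDefect E (v + e₀)‖ ≤ 10 t`. -/
theorem holDefect_pair_bound (h1 : u (-e0) = I * u 0) (h2 : u (-e0 - e1) = -u 0) (h3 : u (-e1) = -I * u 0)
    (hU : ∀ f f', IsCorner v f → IsCorner v f' → ‖u (f' - v) * E (v, f) - u (f - v) * E (v, f')‖ ≤ t)
    (hU' : ∀ f f', IsCorner (v + e0) f → IsCorner (v + e0) f' →
      ‖u (f' - (v + e0)) * E (v + e0, f) - u (f - (v + e0)) * E (v + e0, f')‖ ≤ t)
    (hK : KirchhoffRel E v 0) :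
    ‖u 0‖ * ‖holDefect E v + holDefect E (v + e0)‖ ≤ 10 * t := by
  obtain ⟨d1, -, d3⟩ := coh_defects hU
  obtain ⟨d1', d2', d3'⟩ := coh_defects hU'
  rw [h1] at d1 d1'
  rw [h2] at d2'
  rw [h3] at d3 d3'
  rw [add_sub_cancel_right] at d1' d2'
  have hK' : E (v, v) - E (v + e0, v - e1) = I * (E (v + e0, v) - E (v, v - e1)) := by
    simpa [KirchhoffRel, cornersAt] using hK
  -- abbreviations of the five small quantities
  set A : ℂ := u 0 * E (v, v) with hA
  set B : ℂ := u 0 * E (v + e0, v + e0) with hB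
  set s1 : ℂ := I * u 0 * E (v, v) - u 0 * E (v, v - e0) with hs1
  set s3 : ℂ := -I * u 0 * E (v, v) - u 0 * E (v, v - e1) with hs3
  set s1' : ℂ := I * u 0 * E (v + e0, v + e0) - u 0 * E (v + e0, v) with hs1'
  set s2' : ℂ := -u 0 * E (v + e0, v + e0) - u 0 * E (v + e0, v - e1) with hs2'
  set s3' : ℂ := -I * u 0 * E (v + e0, v + e0) - u 0 * E (v + e0, v + e0 - e1) with hs3'
  have key : u 0 * (holDefect E v + holDefect E (v + e0)) =
      (1 - I) * (-s2' - I * s1' + I * s3) + s1 - I * s3 + s1' - I * s3' := by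
    simp only [holDefect, hs1, hs3, hs1', hs2', hs3', add_sub_cancel_right]
    linear_combination (1 - I) * u 0 * hK' + (-I * (u 0 * E (v, v) + u 0 * E (v + e0, v + e0))) * I_sq
  have n2 : ‖(1 : ℂ) - I‖ ≤ 2 := by
    calc ‖(1 : ℂ) - I‖ ≤ ‖(1 : ℂ)‖ + ‖I‖ := norm_sub_le _ _
      _ = 2 := by rw [norm_one, norm_I]; norm_num
  have i3 : ‖I * s3‖ ≤ t := by rw [norm_mul, norm_I, one_mul]; exact d3
  have i3' : ‖I * s3'‖ ≤ t := by rw [norm_mul, norm_I, one_mul]; exact d3'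
  have i1' : ‖I * s1'‖ ≤ t := by rw [norm_mul, norm_I, one_mul]; exact d1'
  have n2' : ‖-s2'‖ ≤ t := by rw [norm_neg]; exact d2'
  have b0 : ‖-s2' - I * s1' + I * s3‖ ≤ t + t + t := norm_add_le_of_le (norm_sub_le_of_le n2' i1') i3
  have b1 : ‖(1 - I) * (-s2' - I * s1' + I * s3)‖ ≤ 2 * (t + t + t) := by
    rw [norm_mul]; exact mul_le_mul n2 b0 (norm_nonneg _) (by norm_num)
  rw [← norm_mul, key]
  calc ‖(1 - I) * (-s2' - I * s1' + I * s3) + s1 - I * s3 + s1' - I * s3'‖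
      ≤ 2 * (t + t + t) + t + t + t + t :=
        norm_sub_le_of_le (norm_add_le_of_le (norm_sub_le_of_le (norm_add_le_of_le b1 d1) i3) d1') i3'
    _ = 10 * t := by ring

/-- **A non-zero minor kills every corner value** (from `ModeSelection.elim_bound`): with `w = u ∘ classShift` also
coherent at `v` and `d = u(o⋆) w(o) − u(o) w(o⋆)`, every corner value at `v` satisfies `‖E(v,f)‖ · ‖d‖ ≤ 3 S t`,
`S` the sum of the four class norms of `u`. -/
theorem corner_bound_of_minor {os o f : Site 2} (hos : IsCorner 0 os) (ho : IsCorner 0 o) (hf : IsCorner v f)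
    (hU : ∀ f f', IsCorner v f → IsCorner v f' → ‖u (f' - v) * E (v, f) - u (f - v) * E (v, f')‖ ≤ t)
    (hW : ∀ f f', IsCorner v f → IsCorner v f' →
      ‖u (classShift (f' - v)) * E (v, f) - u (classShift (f - v)) * E (v, f')‖ ≤ t) :
    ‖E (v, f)‖ * ‖u os * u (classShift o) - u o * u (classShift os)‖ ≤
      3 * (‖u 0‖ + ‖u (-e0)‖ + ‖u (-e0 - e1)‖ + ‖u (-e1)‖) * t := by
  have ht : 0 ≤ t := (norm_nonneg _).trans (hU _ _ hf hf)
  refine (elim_bound ho hos hf hU hW).trans ?_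
  have hfv : IsCorner 0 (f - v) := fun i => by
    rcases hf i with h | h <;> simp [h]
  have a1 := norm_le_sum_of_isCorner u (isCorner_zero_classShift hfv)
  have a2 := norm_le_sum_of_isCorner u hos
  have a3 := norm_le_sum_of_isCorner u ho
  nlinarith

/-- The holomorphic defect is bounded by the corner values: `‖holDefect E v‖ ≤ 2‖E₀‖ + ‖E_{−e₀}‖ + ‖E_{−e₁}‖`. -/
theorem norm_holDefect_le (E : Site 2 × Site 2 → ℂ) (v : Site 2) :
    ‖holDefect E v‖ ≤ 2 * ‖E (v, v)‖ + ‖E (v, v - e0)‖ + ‖E (v, v - e1)‖ := by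
  have n2 : ‖(1 : ℂ) - I‖ ≤ 2 := by
    calc ‖(1 : ℂ) - I‖ ≤ ‖(1 : ℂ)‖ + ‖I‖ := norm_sub_le _ _
      _ = 2 := by rw [norm_one, norm_I]; norm_num
  calc ‖holDefect E v‖ ≤ ‖(1 - I) * E (v, v)‖ + ‖E (v, v - e0)‖ + ‖I * E (v, v - e1)‖ :=
        norm_add_le_of_le (norm_sub_le_of_le le_rfl le_rfl) le_rfl
    _ ≤ 2 * ‖E (v, v)‖ + ‖E (v, v - e0)‖ + ‖E (v, v - e1)‖ := by
        rw [norm_mul, norm_mul, norm_I, one_mul]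
        gcongr

end Pointwise

/-! ## The character of a coherence vector with vanishing minors -/

/-- **Character selection.** If `u(o⋆) ≠ 0` and all minors `u(o⋆) u(shift o) − u(o) u(shift o⋆)` vanish on the classes,
then `u = u(0) · (1, χ, χ², χ³)` on `0, −e₀, −e₀−e₁, −e₁` with `u(0) ≠ 0` and `χ ∈ {1, −1, i, −i}`. -/
theorem character_of_minors : ∀ {u : Site 2 → ℂ} {os : Site 2}, IsCorner 0 os → u os ≠ 0 → (∀ o, IsCorner 0 o → u os * u (classShift o) - u o * u (classShift os) = 0) → ∃ χ : ℂ, (χ = 1 ∨ χ = -1 ∨ χ = I ∨ χ = -I) ∧ u 0 ≠ 0 ∧ u (-e0) = χ * u 0 ∧ u (-e0 - e1) = χ ^ 2 * u 0 ∧ u (-e1) = χ ^ 3 * u 0 := by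
  intro u os hos hus hC
  obtain ⟨c0, c1, c2, c3⟩ := isCorner_zero_classes
  set χ : ℂ := u (classShift os) / u os with hχ
  have hshift : ∀ o, IsCorner 0 o → u (classShift o) = χ * u o := fun o ho => by
    have h := hC o ho
    rw [hχ]; field_simp; linear_combination h
  have h0 := hshift _ c0; rw [classShift_zero] at h0
  have h1 := hshift _ c1; rw [classShift_neg_e0] at h1
  have h2 := hshift _ c2; rw [classShift_neg_e0_sub_e1] at h2
  have h3 := hshift _ c3; rw [classShift_neg_e1] at h3
  have hu0 : u 0 ≠ 0 := by
    intro hz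
    have a1 : u (-e0) = 0 := by rw [h0, hz, mul_zero]
    have a2 : u (-e0 - e1) = 0 := by rw [h1, a1, mul_zero]
    have a3 : u (-e1) = 0 := by rw [h2, a2, mul_zero]
    rcases eq_of_isCorner_zero hos with h | h | h | h <;> rw [h] at hus
    · exact hus hz
    · exact hus a1
    · exact hus a2
    · exact hus a3
  have q1 : u (-e0) = χ * u 0 := h0
  have q2 : u (-e0 - e1) = χ ^ 2 * u 0 := by rw [h1, q1]; ring
  have q3 : u (-e1) = χ ^ 3 * u 0 := by rw [h2, q2]; ring
  have q4 : u 0 = χ ^ 4 * u 0 := by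
    calc u 0 = χ * u (-e1) := h3
      _ = χ ^ 4 * u 0 := by rw [q3]; ring
  have hχ4 : χ ^ 4 = 1 := by
    have : (χ ^ 4 - 1) * u 0 = 0 := by linear_combination (-1 : ℂ) * q4
    simpa [sub_eq_zero, hu0] using this
  have hprod : (χ - 1) * (χ + 1) * (χ - I) * (χ + I) = 0 := by
    linear_combination hχ4 + (1 - χ ^ 2) * I_sq
  refine ⟨χ, ?_, hu0, q1, q2, q3⟩
  rcases mul_eq_zero.1 hprod with h | h
  · rcases mul_eq_zero.1 h with h | h
    · rcases mul_eq_zero.1 h with h | h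
      · exact Or.inl (sub_eq_zero.1 h)
      · exact Or.inr (Or.inl (eq_neg_of_add_eq_zero_left h))
    · exact Or.inr (Or.inr (Or.inl (sub_eq_zero.1 h)))
  · exact Or.inr (Or.inr (Or.inr (eq_neg_of_add_eq_zero_left h)))

end Summit.CriticalPhenomena.CardyFormulaZ2.Cruxes.ParafermionToSLESixFamilies.PotentialDarbouxPicardDiamond

end
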